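import Summits.ResolutionOfSingularities.ResolutionOfSingularities.Theorems.FrobeniusClosingSteerBetaLetterMonomial
import Summits.ResolutionOfSingularities.ResolutionOfSingularities.Theorems.FrobeniusClosingSteerBetaPolygonGauge
import Summits.ResolutionOfSingularities.ResolutionOfSingularities.Theorems.FrobeniusClosingSteerBetaShear
import HarnessLib

/-!
# Crux `Steer` (stmt-ResolutionOfSingularities-16345), chain W4.1, β-LEAF (hK4′), K-β2♭ part (I), file 3: WORDS-LEVEL forms of the
# representative-level letter laws over the tree words `BetaPolygon.AlphaGe` / `DeltaGe` / `BetaGe` (Theses-free, def-free)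

OURS (campaign `res-hironaka`, rung L ★L-G4, slot W4.1; statements about the route's own objects; they replace the
role of no printed item and are NOT statements of the manuscript under review [claim: Hironaka2017, status:
under-review]; AI review is weaker than expert review). Seat res-D-pv-003 (gen 6), K-β2♭ kernel owner (res-L0-w41-plan-1 RULINGS 143/150 (2)/169b; res-L0-w41-idea-1 v18.1
`XLetterPushHat` / `YLetterPushHat`, res-L0-w41-tri-2 TRIAGE v23/v23.1 (I) PASS with the dimension binder J2). `alphaGe_of_poly`,
`betaGe_of_poly` (region ideal ⇒ word); the four conjuncts of (I) at WORDS level: `alphaGe_x_letter_of_deltaGe` (CJS 12.1 (3):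
`DeltaGe ρ f → AlphaGe (φ x) z₁ w₁ d (ρ − 1) f₁`), `betaGe_x_letter_of_deltaFaceGe` (`DeltaFaceGe δ ρ f → BetaGe (φ x) v₁ z₁ w₁ d (δ − 1) ρ f₁`),
`alphaGe_y_letter` (CJS 12.2 (2): `AlphaGe ρ f → f ∈ 𝔪^d → AlphaGe x₁ z₁ w₁ d ρ f₁`, regular local of dimension four — the binder is
NECESSARY, witness `x := y²` in a three-dimensional regular ring), `betaGe_y_letter` (CJS 12.2 (3): `BetaGe α ρ f → BetaGe x₁ (φ y) z₁ w₁ d α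
(α + ρ − 1) f₁`); `betaGe_shear_iff` (`BetaGe` is shear-invariant, `…BetaShear`). No Theses file is imported; nothing here is a route item
or a registration. [cite: CossartJannsenSaito2020, Lemma 12.2] [cite: CossartJannsenSaito2020, Lemma 12.1] [cite: CossartJannsenSaito2020, Lemma 13.6]
-/

noncomputable section

-- `Summit.<S>.<S>.…` duplicates the summit name by design (single-problem summit).
set_option linter.dupNamespace false

namespace Summit.ResolutionOfSingularities.ResolutionOfSingularities.Theorems.SwitchingDichotomy.BetaLetter

variable {S S₁ : Type} [CommRing S] [CommRing S₁]

/-! ## §5 Words-level forms over the tree words `BetaPolygon.AlphaGe` / `DeltaGe` / `BetaGe` -/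

section Words

open nonZeroDivisors

/-- A region ideal of `α`-shape gives the WORD `AlphaGe`. [folklore] -/
theorem alphaGe_of_poly {x z₁ w₁ f₁ : S₁} {d : ℕ} {ρ : ℚ}
    (h : f₁ ∈ Ideal.span {z₁, w₁} ^ d ⊔ ⨆ (i : ℕ) (j : ℕ) (_ : i + j < d) (a : ℕ)
      (_ : ⌈ρ * ((d - i - j : ℕ) : ℚ)⌉₊ ≤ a), Ideal.span {x ^ a * z₁ ^ i * w₁ ^ j}) :
    BetaPolygon.AlphaGe x z₁ w₁ d ρ f₁ :=
  poly_alpha_le x z₁ w₁ d ρ h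

/-- A region ideal of `β`-shape gives the WORD `BetaGe`. [folklore] -/
theorem betaGe_of_poly {x v z₁ w₁ f₁ : S₁} {d : ℕ} {α ρ : ℚ}
    (h : f₁ ∈ Ideal.span {z₁, w₁} ^ d ⊔ ⨆ (i : ℕ) (j : ℕ) (_ : i + j < d) (a : ℕ) (b : ℕ)
      (_ : ⌊α * ((d - i - j : ℕ) : ℚ)⌋₊ + 1 ≤ a ∨
        (⌈α * ((d - i - j : ℕ) : ℚ)⌉₊ ≤ a ∧ ⌈ρ * ((d - i - j : ℕ) : ℚ)⌉₊ ≤ b)),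
      Ideal.span {x ^ a * v ^ b * z₁ ^ i * w₁ ^ j}) :
    BetaPolygon.BetaGe x v z₁ w₁ d α ρ f₁ :=
  poly_beta_le x v z₁ w₁ d α ρ h

/-- **X-letter `α`-law, WORDS level** (CJS 12.1 (3) push-forward half «`δ ≥ ρ ⇒ α₁ ≥ ρ − 1`», any shear constant `c₁`):
`DeltaGe x y z w d ρ f → AlphaGe (φ x) z₁ w₁ d (ρ − 1) f₁`. [cite: CossartJannsenSaito2020, Lemma 12.1] -/
theorem alphaGe_x_letter_of_deltaGe (φ : S →+* S₁) {x y z w f : S} {c₁ v₁ z₁ w₁ f₁ : S₁} {d : ℕ}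
    (hx : φ x ∈ S₁⁰) (hy : φ y = φ x * (c₁ + v₁)) (hz : φ z = φ x * z₁) (hw : φ w = φ x * w₁)
    (hf : φ f = φ x ^ d * f₁) {ρ : ℚ} (hρ : 1 ≤ ρ) (hδ : BetaPolygon.DeltaGe x y z w d ρ f) :
    BetaPolygon.AlphaGe (φ x) z₁ w₁ d (ρ - 1) f₁ :=
  alphaGe_of_poly (alpha_x_letter φ hx hy hz hw hf hρ (delta_le_poly x y z w d ρ hδ))

/-- **The `β`-threshold word is shear-invariant** (`…BetaShear.betaThreshold_shear`, CJS Lemma 13.6 in ideal form).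
[cite: CossartJannsenSaito2020, Lemma 13.6] -/
theorem betaGe_shear_iff (x y z w c : S) (d : ℕ) (α ρ : ℚ) (f : S) :
    BetaPolygon.BetaGe x y z w d α ρ f ↔ BetaPolygon.BetaGe x (y - c * x) z w d α ρ f := by
  unfold BetaPolygon.BetaGe
  rw [BetaShear.betaThreshold_shear x y z w c d α ρ]

/-- **X-letter `β`-law on the face, WORDS level** (CJS 12.1 (3)/(4) push-forward half «`γ⁻ ≥ ρ` on the `δ`-face ⇒ `β₁ ≥ ρ` on the
column `δ − 1`», no shear, `1 ≤ δ`): `DeltaFaceGe x y z w d δ ρ f → BetaGe (φ x) v₁ z₁ w₁ d (δ − 1) ρ f₁`.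
[cite: CossartJannsenSaito2020, Lemma 12.1] -/
theorem betaGe_x_letter_of_deltaFaceGe (φ : S →+* S₁) {x y z w f : S} {v₁ z₁ w₁ f₁ : S₁} {d : ℕ}
    (hx : φ x ∈ S₁⁰) (hy : φ y = φ x * v₁) (hz : φ z = φ x * z₁) (hw : φ w = φ x * w₁)
    (hf : φ f = φ x ^ d * f₁) {δ ρ : ℚ} (hδ : 1 ≤ δ) (hface : BetaPolygon.DeltaFaceGe x y z w d δ ρ f) :
    BetaPolygon.BetaGe (φ x) v₁ z₁ w₁ d (δ - 1) ρ f₁ :=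
  beta_x_law_of_deltaFace φ hx hy hz hw hf hδ hface

/-- **Y-letter `α`-law, WORDS level** (CJS 12.2 (2) push-forward half «`α ≥ ρ`, `f ∈ 𝔪^d` ⇒ `α₁ ≥ ρ`»), for a regular local ring of
dimension four with `(x, y, z, w) = 𝔪` (the dimension binder is necessary: `AlphaGe ∩ 𝔪^d` is computed monomial-wise in the r.s.o.p.).
[cite: CossartJannsenSaito2020, Lemma 12.2] -/
theorem alphaGe_y_letter [IsLocalRing S] (hreg : IsRegularLocalRing S) (hdim : ringKrullDim S = 4) {x y z w f : S}
    (hspan : Ideal.span {x, y, z, w} = IsLocalRing.maximalIdeal S) (φ : S →+* S₁) {x₁ z₁ w₁ f₁ : S₁} {d : ℕ}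
    (hy : φ y ∈ S₁⁰) (hx : φ x = φ y * x₁) (hz : φ z = φ y * z₁) (hw : φ w = φ y * w₁) (hf : φ f = φ y ^ d * f₁)
    (hfd : f ∈ IsLocalRing.maximalIdeal S ^ d) {ρ : ℚ} (hρ : 0 ≤ ρ) (hα : BetaPolygon.AlphaGe x z w d ρ f) :
    BetaPolygon.AlphaGe x₁ z₁ w₁ d ρ f₁ :=
  alpha_y_law hreg hdim hspan φ hy hx hz hw hf hfd hρ hα

/-- **Y-letter `β`-law, WORDS level** (CJS 12.2 (3) push-forward half «column `(α, β ≥ ρ)`, `f ∈ 𝔪^d` ⇒ `β₁ ≥ α + ρ − 1` on the column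
`α`»), `0 ≤ α`, `0 ≤ ρ`, regular local of dimension four with `(x, y, z, w) = 𝔪`. [cite: CossartJannsenSaito2020, Lemma 12.2] -/
theorem betaGe_y_letter [IsLocalRing S] (hreg : IsRegularLocalRing S) (hdim : ringKrullDim S = 4) {x y z w f : S}
    (hspan : Ideal.span {x, y, z, w} = IsLocalRing.maximalIdeal S) (φ : S →+* S₁) {x₁ z₁ w₁ f₁ : S₁} {d : ℕ}
    (hy : φ y ∈ S₁⁰) (hx : φ x = φ y * x₁) (hz : φ z = φ y * z₁) (hw : φ w = φ y * w₁) (hf : φ f = φ y ^ d * f₁)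
    (hfd : f ∈ IsLocalRing.maximalIdeal S ^ d) {α ρ : ℚ} (hα0 : 0 ≤ α) (hρ : 0 ≤ ρ)
    (hβ : BetaPolygon.BetaGe x y z w d α ρ f) :
    BetaPolygon.BetaGe x₁ (φ y) z₁ w₁ d α (α + ρ - 1) f₁ :=
  beta_y_law hreg hdim hspan φ hy hx hz hw hf hfd hα0 hρ hβ

/-- **(I-X) packaged** — the two conjuncts of res-L0-w41-idea-1's `XLetterPushHat` for one chart datum (any commutative rings; the
law is dimension-free): `δ ≥ ρ ⇒ α₁ ≥ ρ − 1` (`1 ≤ ρ`) and `γ⁻ ≥ ρ` on the `δ`-face ⇒ `β₁ ≥ ρ` on the column `δ − 1` (`1 ≤ δ`).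
[cite: CossartJannsenSaito2020, Lemma 12.1] -/
theorem xLetterPush (φ : S →+* S₁) {x y z w f : S} {t z₁ w₁ f₁ : S₁} {d : ℕ}
    (hx : φ x ∈ S₁⁰) (hy : φ y = φ x * t) (hz : φ z = φ x * z₁) (hw : φ w = φ x * w₁) (hf : φ f = φ x ^ d * f₁) :
    (∀ ρ : ℚ, 1 ≤ ρ → BetaPolygon.DeltaGe x y z w d ρ f → BetaPolygon.AlphaGe (φ x) z₁ w₁ d (ρ - 1) f₁) ∧
    (∀ δ ρ : ℚ, 1 ≤ δ → 0 ≤ ρ → BetaPolygon.DeltaFaceGe x y z w d δ ρ f → BetaPolygon.BetaGe (φ x) t z₁ w₁ d (δ - 1) ρ f₁) := by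
  refine ⟨fun ρ hρ hδ => ?_, fun δ ρ hδ _ hface => betaGe_x_letter_of_deltaFaceGe φ hx hy hz hw hf hδ hface⟩
  have hy' : φ y = φ x * (0 + t) := by rw [zero_add]; exact hy
  exact alphaGe_x_letter_of_deltaGe φ hx hy' hz hw hf hρ hδ

/-- **(I-Y) packaged** — the two conjuncts of `YLetterPushHat` for one chart datum, WITH the dimension binder (J2): `α ≥ ρ ⇒ α₁ ≥ ρ`
(`0 ≤ ρ`) and column `(α, β ≥ ρ)` ⇒ `β₁ ≥ α + ρ − 1` (`0 ≤ α, ρ`), given `f ∈ 𝔪^d`. [cite: CossartJannsenSaito2020, Lemma 12.2] -/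
theorem yLetterPush [IsLocalRing S] (hreg : IsRegularLocalRing S) (hdim : ringKrullDim S = 4) {x y z w f : S}
    (hspan : Ideal.span {x, y, z, w} = IsLocalRing.maximalIdeal S) (φ : S →+* S₁) {x₁ z₁ w₁ f₁ : S₁} {d : ℕ}
    (hy : φ y ∈ S₁⁰) (hx : φ x = φ y * x₁) (hz : φ z = φ y * z₁) (hw : φ w = φ y * w₁) (hf : φ f = φ y ^ d * f₁)
    (hfd : f ∈ IsLocalRing.maximalIdeal S ^ d) :
    (∀ ρ : ℚ, 0 ≤ ρ → BetaPolygon.AlphaGe x z w d ρ f → BetaPolygon.AlphaGe x₁ z₁ w₁ d ρ f₁) ∧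
    (∀ α ρ : ℚ, 0 ≤ α → 0 ≤ ρ → BetaPolygon.BetaGe x y z w d α ρ f →
      BetaPolygon.BetaGe x₁ (φ y) z₁ w₁ d α (α + ρ - 1) f₁) :=
  ⟨fun _ hρ hα => alphaGe_y_letter hreg hdim hspan φ hy hx hz hw hf hfd hρ hα,
    fun _ _ hα0 hρ hβ => betaGe_y_letter hreg hdim hspan φ hy hx hz hw hf hfd hα0 hρ hβ⟩

end Words

end Summit.ResolutionOfSingularities.ResolutionOfSingularities.Theorems.SwitchingDichotomy.BetaLetter

end
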